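import Summits.QuantumFields.BalabanUV.Beta.ResolventFinCertificateTaylor
import Summits.QuantumFields.BalabanUV.Beta.CoverSchedules

/-!
# Beta / ResolventFinLeafRecord — THE FIN LEAF AS A KERNEL OBJECT: the numeric content of the order-m fin socket
# `ResolventFinCertificateTaylor.fin_certificate_taylor` as a record over `ℚ` with a DECIDABLE validity predicate, `certifies`, and the
# binder `hcertF` of the schedule anchors from one record per fin-schedule leaf
# (β sub-cell, BINDER-OWNERS row CAP-k, lineage `b2b-balaban-beta-an5`, gen 26; node BETA-an5-g26-SCHEDULES, leaf 6; journal l.17735 ∕ l.18475)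

cap3-g18's J29 (journal l.18345, «THE FINS PRICED») settles the fin engine's shape: «a plain dense Taylor-inverse ∕ Krawczyk leaf of order 1–2 in
`(δ_x, δ_τ)` on each colour block — no closed form, no hG — feeding `ResolventFinCertificateTaylor`», ≈ 30–170 rectangles per fin at
`h ≈ 0.07–0.3` (core-seconds), the worst leaf at the bad-spot corner `(τ, x) = (1, ±π)`.  The box deliverable already is a named kernel
structure (`ResolventLeafRecord.BlockLeafRecord`, p228449); THIS LEAF does the same for the fin deliverable:

* §1 **`FinLeafRecord`** — `(m, p, ε, T, θ)` over `ℕ × ℚ⁴`: the order, the sup `p ≥ ‖P(τ,x)‖` of the engine's preconditioner family on the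
  rectangle, the residual `ε ≥ ‖1 − P·taylorFamilyFin‖` against the KERNEL's Taylor family, a bound `T ≥ taylorTailFin` of the KERNEL's
  closed-form tail (a finite sum over the tables — a rational the engine states and, once tables are typed, the kernel recomputes), the
  contraction `θ`; **`Valid`** = `0 < m ∧ 0 ≤ p ∧ ε + p·T ≤ θ ∧ θ < 1`, DECIDABLE (`decide +kernel` ∕ `norm_num`); the rectangle is NOT a
  field — it is the schedule's leaf;
* §2 **`certifies`** — `Valid` + (`hsmall`: the rectangle is inside the unit Taylor radius of every stencil phase) + the three engine sups
  `hE`, `hP`, `hT` ⟹ on the whole rectangle `IsUnit (A p).det ∧ ‖(A p)⁻¹‖ ≤ p∕(1−θ)` for the stencil family `A q = Σ_R χ_q(R)·K[R]`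
  (`fin_certificate_taylor`);
* §3 **`hcertF_of_finRecords`** — for fin schedules `F : Fin 4 → Sched 1` (`CoverSchedules.finRects`) and one record per leaf, the binder
  `hcertF` of `CapRouteASchedules.…_ofSchedules` ∕ `ResolventLeafRecord.…_ofRecords(_ofRealBall ∕ _ofPairedBall₀)` for
  `A := fun q => Σ_R χ_q(R)·K[R]` (all-plus fins: slope `σ = κ`, `c ≡ κ`).

WHAT STAYS OUTSIDE THE KERNEL per fin leaf: the sups `p`, `ε` (two engines) and — until the tables are typed — the tail bound `T`; the
arithmetic side condition and the rectangle cover are kernel.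

HONEST FRAMING.  Kernel glue ([folklore]); no record for the cell's `k₀`, no rectangle, no number supplied (the `example` is on
illustrative rationals); 0 binders instantiated; 0 certified coefficients; J29 PRICES fin leaves, certifies none.  Discharging `BetaPertH`
would make Bałaban's ultraviolet stability unconditional — NOT the continuum limit, NOT the Clay problem.  HONEST DEPENDENCY: continuum YM on T⁴ ⇐ BetaPertH ∧ nine spine estimates (0/9 proved); BetaPertH ⇐ (D1) ∧ (D4) ∧ CAP+tail; G-an2-4 gates asym, D1 and NE2/3/4.
v1.0.1 (DOCFIX, XREAD beta-num-g40 l.18870 F1∕I1): docstrings only; declarations byte-identical.  0 `sorry`, 0 cite tags.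
-/

namespace Summit.QuantumFields.BalabanUV.Beta.ResolventFinLeafRecord

open Complex Set Matrix
open Summit.QuantumFields.BalabanUV.Beta.PolyRegularAlgebra (character)
open Summit.QuantumFields.BalabanUV.Beta.ResolventFinCertificate (finRate taylorFamilyFin taylorTailFin fin_certificate_taylor)
open Summit.QuantumFields.BalabanUV.Beta.CoverSchedules (Sched finRects finRects_subset)
open scoped Real Matrix.Norms.L2Operator

noncomputable section

variable {d : ℕ} {n : Type*} [Fintype n] [DecidableEq n]

/-! ## §1 The fin-leaf record over `ℚ` -/

/-- **THE FIN-LEAF RECORD**: the numeric content of `fin_certificate_taylor` — order `m`, preconditioner-norm sup `p`, residual `ε` against the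
kernel's Taylor family, tail bound `T`, contraction `θ` — exact rationals; the rectangle is the schedule leaf, not a field. [folklore] -/
structure FinLeafRecord where
  /-- the Taylor order `m ≥ 1`. -/
  m : ℕ
  /-- `p ≥ sup ‖P(τ, x)‖` over the rectangle. -/
  p : ℚ
  /-- `ε ≥ sup ‖1 − P(τ, x) · taylorFamilyFin m … τ x‖` over the rectangle. -/
  ε : ℚ
  /-- `T ≥ taylorTailFin m S K i σ c τ₀ hτ hx` (the kernel's closed-form tail, a finite sum over the tables). -/
  T : ℚ
  /-- the contraction constant: the record claims `‖(A p)⁻¹‖ ≤ p ∕ (1 − θ)` on the rectangle. -/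
  θ : ℚ

namespace FinLeafRecord

variable (r : FinLeafRecord)

/-- **VALIDITY** = `0 < m ∧ 0 ≤ p ∧ ε + p·T ≤ θ ∧ θ < 1` — the arithmetic side of `fin_certificate_taylor`, in exact rationals. [folklore] -/
def Valid : Prop := 0 < r.m ∧ 0 ≤ r.p ∧ r.ε + r.p * r.T ≤ r.θ ∧ r.θ < 1

/-- validity is DECIDABLE: a fin record is checked in the kernel by `decide +kernel` ∕ `norm_num` (plain `decide` does not reduce `Rat`
arithmetic at default transparency — XREAD beta-num-g40 F1). [folklore] -/
instance decidableValid : Decidable r.Valid := by unfold Valid; infer_instance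

/-- the certified resolvent-norm budget of the record, `p ∕ (1 − θ)`. [folklore] -/
def budget : ℚ := r.p / (1 - r.θ)

/-! ## §2 A valid record certifies its rectangle -/

/-- **A VALID FIN RECORD CERTIFIES ITS RECTANGLE**: for the stencil family `A q = Σ_{R ∈ S} χ_q(R)·K[R]` on the fin of coordinate `i`, slope `σ`,
transverse imaginary parts `c`, rectangle `|τ − τ₀| ≤ hτ`, `|x − x₀| ≤ hx` inside the unit Taylor radius (`hsmall`): validity + the engine
sups `hE` (residual against the kernel's Taylor family), `hP` (preconditioner norm) + the tail bound `hT` ⟹ `IsUnit (A p).det` and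
`‖(A p)⁻¹‖ ≤ p∕(1−θ)` at every fin point of the rectangle. [folklore] -/
theorem certifies (hv : r.Valid) (S : Finset (Fin (d + 1) → ℤ)) (K : (Fin (d + 1) → ℤ) → Matrix n n ℂ)
    (i : Fin (d + 1)) (σ : ℝ) (c : Fin d → ℝ) {τ₀ x₀ hτ hx : ℝ}
    (hsmall : ∀ R ∈ S, |finRate R i σ c| * hτ + |(R i : ℝ)| * hx ≤ 1)
    {P : ℝ → ℝ → Matrix n n ℂ}
    (hE : ∀ τ x : ℝ, |τ - τ₀| ≤ hτ → |x - x₀| ≤ hx → ‖1 - P τ x * taylorFamilyFin r.m S K i σ c τ₀ x₀ τ x‖ ≤ r.ε)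
    (hP : ∀ τ x : ℝ, |τ - τ₀| ≤ hτ → |x - x₀| ≤ hx → ‖P τ x‖ ≤ r.p)
    (hT : taylorTailFin r.m S K i σ c τ₀ hτ hx ≤ r.T) :
    ∀ τ x : ℝ, |τ - τ₀| ≤ hτ → |x - x₀| ≤ hx →
      IsUnit (∑ R ∈ S, character R (i.insertNth ((x : ℂ) + ((τ * σ : ℝ) : ℂ) * I) fun j => ((τ * c j : ℝ) : ℂ) * I) • K R).det ∧
        ‖(∑ R ∈ S, character R (i.insertNth ((x : ℂ) + ((τ * σ : ℝ) : ℂ) * I) fun j => ((τ * c j : ℝ) : ℂ) * I) • K R)⁻¹‖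
          ≤ r.p / (1 - r.θ) := by
  obtain ⟨hm, hp, hθ, hθ1⟩ := hv
  have hp' : (0 : ℝ) ≤ r.p := by exact_mod_cast hp
  have hθ' : (r.ε : ℝ) + r.p * taylorTailFin r.m S K i σ c τ₀ hτ hx ≤ r.θ := by
    have h1 : (r.ε : ℝ) + r.p * r.T ≤ r.θ := by exact_mod_cast hθ
    have h2 : (r.p : ℝ) * taylorTailFin r.m S K i σ c τ₀ hτ hx ≤ r.p * r.T := mul_le_mul_of_nonneg_left hT hp'
    linarith
  have hθ1' : (r.θ : ℝ) < 1 := by exact_mod_cast hθ1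
  have h := fin_certificate_taylor hm S K i σ c hsmall hE hP hp' hθ' hθ1'
  intro τ x hτ' hx'
  exact h τ x hτ' hx'

end FinLeafRecord

/-- ARITHMETIC DEMO (illustrative rationals, NOT a certificate, NOT a leaf of any cover): an order-2 record with `p = 40`, `ε = 1∕10`,
`T = 1∕200`, `θ = 1∕2` is valid (`1∕10 + 40·(1∕200) = 3∕10 ≤ 1∕2`); the kernel DECIDES it. [folklore] -/
example : (⟨2, 40, 1 / 10, 1 / 200, 1 / 2⟩ : FinLeafRecord).Valid := by
  unfold FinLeafRecord.Valid; norm_num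

/-- … and refutes the same record at `θ = 1∕4`. [folklore] -/
example : ¬ (⟨2, 40, 1 / 10, 1 / 200, 1 / 4⟩ : FinLeafRecord).Valid := by
  unfold FinLeafRecord.Valid; norm_num

/-! ## §3 `hcertF` from fin records over fin schedules -/

section Schedules

/-- **`hcertF` FROM FIN RECORDS**: for the stencil family `A q = Σ_R χ_q(R)·K[R]`, four fin schedules `F : Fin 4 → Sched 1` on `[0,1] × [−π,π]`
(leaves `bx`: `τ`-centre `bx.1 0`, `τ`-half-width `bx.2 0`, `x`-centre `bx.1 1`, `x`-half-width `bx.2 1`), one record per (coordinate, leaf),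
each valid, each leaf inside the unit Taylor radius, and per leaf the sups `hE`, `hP` + the tail bound `hT` ⟹ the binder `hcertF` of
`CapRouteASchedules.rowsOfOneLoopFormCode16E_routeA₂_ofSchedules` ∕ `ResolventLeafRecord.…_ofRecords` ∕ `CapRouteARealBall.…` VERBATIM (all-plus
fins of slope `κ`: `σ = κ`, `c ≡ κ`). [folklore] -/
theorem hcertF_of_finRecords (S : Finset (Fin (3 + 1) → ℤ)) (K : (Fin (3 + 1) → ℤ) → Matrix n n ℂ) (κ : ℝ)
    (F : Fin (3 + 1) → Sched 1) (frec : Fin (3 + 1) → (Fin (1 + 1) → ℝ) × (Fin (1 + 1) → ℝ) → FinLeafRecord)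
    (hvalid : ∀ (i : Fin (3 + 1)), ∀ bx ∈ finRects (F i), (frec i bx).Valid)
    (hsmall : ∀ (i : Fin (3 + 1)), ∀ bx ∈ finRects (F i), ∀ R ∈ S,
      |finRate R i κ (fun _ => κ)| * bx.2 0 + |(R i : ℝ)| * bx.2 1 ≤ 1)
    {P : Fin (3 + 1) → (Fin (1 + 1) → ℝ) × (Fin (1 + 1) → ℝ) → ℝ → ℝ → Matrix n n ℂ}
    (hE : ∀ (i : Fin (3 + 1)), ∀ bx ∈ finRects (F i), ∀ τ x : ℝ, |τ - bx.1 0| ≤ bx.2 0 → |x - bx.1 1| ≤ bx.2 1 →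
      ‖1 - P i bx τ x * taylorFamilyFin (frec i bx).m S K i κ (fun _ => κ) (bx.1 0) (bx.1 1) τ x‖ ≤ (frec i bx).ε)
    (hP : ∀ (i : Fin (3 + 1)), ∀ bx ∈ finRects (F i), ∀ τ x : ℝ, |τ - bx.1 0| ≤ bx.2 0 → |x - bx.1 1| ≤ bx.2 1 →
      ‖P i bx τ x‖ ≤ (frec i bx).p)
    (hT : ∀ (i : Fin (3 + 1)), ∀ bx ∈ finRects (F i),
      taylorTailFin (frec i bx).m S K i κ (fun _ => κ) (bx.1 0) (bx.2 0) (bx.2 1) ≤ (frec i bx).T) :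
    ∀ (i : Fin (3 + 1)), ∀ bx ∈ finRects (F i), ∀ τ x : ℝ, |τ - bx.1 0| ≤ bx.2 0 → |x - bx.1 1| ≤ bx.2 1 →
      IsUnit ((fun q => ∑ R ∈ S, character R q • K R)
        (i.insertNth ((x : ℂ) + ((τ * κ : ℝ) : ℂ) * I) fun _ => ((τ * κ : ℝ) : ℂ) * I)).det := by
  intro i bx hbx τ x hτ' hx'
  exact ((frec i bx).certifies (hvalid i bx hbx) S K i κ (fun _ => κ) (hsmall i bx hbx) (hE i bx hbx) (hP i bx hbx) (hT i bx hbx)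
    τ x hτ' hx').1

/-- the same records also deliver the RESOLVENT-NORM bound on the fins (not consumed by the row's anchors — the (Z2a) bound lives on the vertex
tori — but it is what the engine's fin leaf proves, recorded for the cross-reader). [folklore] -/
theorem invNorm_le_of_finRecords (S : Finset (Fin (3 + 1) → ℤ)) (K : (Fin (3 + 1) → ℤ) → Matrix n n ℂ) (κ : ℝ)
    (F : Fin (3 + 1) → Sched 1) (frec : Fin (3 + 1) → (Fin (1 + 1) → ℝ) × (Fin (1 + 1) → ℝ) → FinLeafRecord)
    (hvalid : ∀ (i : Fin (3 + 1)), ∀ bx ∈ finRects (F i), (frec i bx).Valid)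
    (hsmall : ∀ (i : Fin (3 + 1)), ∀ bx ∈ finRects (F i), ∀ R ∈ S,
      |finRate R i κ (fun _ => κ)| * bx.2 0 + |(R i : ℝ)| * bx.2 1 ≤ 1)
    {P : Fin (3 + 1) → (Fin (1 + 1) → ℝ) × (Fin (1 + 1) → ℝ) → ℝ → ℝ → Matrix n n ℂ}
    (hE : ∀ (i : Fin (3 + 1)), ∀ bx ∈ finRects (F i), ∀ τ x : ℝ, |τ - bx.1 0| ≤ bx.2 0 → |x - bx.1 1| ≤ bx.2 1 →
      ‖1 - P i bx τ x * taylorFamilyFin (frec i bx).m S K i κ (fun _ => κ) (bx.1 0) (bx.1 1) τ x‖ ≤ (frec i bx).ε)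
    (hP : ∀ (i : Fin (3 + 1)), ∀ bx ∈ finRects (F i), ∀ τ x : ℝ, |τ - bx.1 0| ≤ bx.2 0 → |x - bx.1 1| ≤ bx.2 1 →
      ‖P i bx τ x‖ ≤ (frec i bx).p)
    (hT : ∀ (i : Fin (3 + 1)), ∀ bx ∈ finRects (F i),
      taylorTailFin (frec i bx).m S K i κ (fun _ => κ) (bx.1 0) (bx.2 0) (bx.2 1) ≤ (frec i bx).T) :
    ∀ (i : Fin (3 + 1)), ∀ bx ∈ finRects (F i), ∀ τ x : ℝ, |τ - bx.1 0| ≤ bx.2 0 → |x - bx.1 1| ≤ bx.2 1 →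
      ‖(∑ R ∈ S, character R (i.insertNth ((x : ℂ) + ((τ * κ : ℝ) : ℂ) * I) fun _ => ((τ * κ : ℝ) : ℂ) * I) • K R)⁻¹‖
        ≤ (frec i bx).p / (1 - (frec i bx).θ) := by
  intro i bx hbx τ x hτ' hx'
  exact ((frec i bx).certifies (hvalid i bx hbx) S K i κ (fun _ => κ) (hsmall i bx hbx) (hE i bx hbx) (hP i bx hbx) (hT i bx hbx)
    τ x hτ' hx').2

/-- every fin-schedule leaf is a rectangle of `[0,1] × [−π,π]` — so a record is never asked outside the fin (re-export of
`CoverSchedules.finRects_subset` in the record's reading). [folklore] -/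
theorem leaf_subset (F : Sched 1) {bx : (Fin (1 + 1) → ℝ) × (Fin (1 + 1) → ℝ)} (hbx : bx ∈ finRects F) {τ x : ℝ}
    (hτ : |τ - bx.1 0| ≤ bx.2 0) (hx : |x - bx.1 1| ≤ bx.2 1) : τ ∈ Icc (0 : ℝ) 1 ∧ x ∈ Icc (-π) π :=
  finRects_subset F hbx hτ hx

end Schedules

end

end Summit.QuantumFields.BalabanUV.Beta.ResolventFinLeafRecord
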